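/-
Copyright (c) 2026. Released under the Apache 2.0 license.
-/
import Literature.NumberTheory.EllipticCurves.IsogenyCyclicKernelCoatesProofs
import HarnessLib

/-!
# `Δ(E)^{deg φ} = Δ(E')·c⁴` (`c ∈ K`) along a `K`-isogeny of ODD degree, and
# `3·v_p(Δ_min(E)) ≡ v_p(Δ_min(E')) (mod 4)` for a `3`-isogeny
# (Dokchitser–Dokchitser 2015, §2 Thm. 5 and §3 Thm. 6 at `p = 3`; proofs only)

Topic `NumberTheory/EllipticCurves`; THEOREMS ONLY; sequel of
`IsogenyOddKernelDiscriminantProofs` (`Isogeny.exists_unit_Δ_pow_card_ker_eq`: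
`Δ(E)^{#ker φ} = u¹²·Δ(E')·Π_{v ∈ ker φ ∖ O}(2y(v))⁴` in `K̄`, `u ∈ Kˣ`, for a kernel without
`2`-torsion) and companion of `IsogenyCyclicKernelCoatesProofs` (the `12`-th power form for cyclic
kernels of order prime to `6`). The complementary case of the printed table is the `3`-isogeny:

> Dokchitser–Dokchitser, *Local invariants of isogenous elliptic curves*, Trans. AMS 367 (2015)
> = arXiv:1208.5519, §2 **Theorem 5**: "Let `𝒦` be a field of characteristic `0` and
> `φ : E → E'` a `3`-isogeny of elliptic curves over `𝒦`. Then `Δ³/Δ'` is a 4th power in `𝒦`."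
> (held text `paper:arxiv-1208.5519` p. 5), whence in §3 **Theorem 6** the congruence
> `δ' ≡ pδ (mod 12)` also at `p = 3` (p. 6: "The last congruence follows from Theorems 3–5").

Printed proof of Thm. 5: the universal family `E : y² = x³ + a(x − b)²`,
`E' : y² = x³ + ax² + 18abx + ab(16a − 27b)`, `Δ³/Δ' = (4ab²)⁴`. Proof here (same mechanism as
the tree's Thm. 3): Vélu's quotient and its uniqueness give
`Δ(E)^{#ker φ} = u¹²·Δ(E')·N⁴` with `N = Π_{v ∈ ker φ ∖ O} 2y(v)` (tree); the kernel of a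
`K`-isogeny is `Γ_K`-stable and `σ` acts on coordinates, so `σ` permutes the factors of `N` and
`N ∈ K̄^{Γ_K} = K` (`Isogeny.prod_two_mul_yOf_mem_range`); thus `Δ(E)^{deg φ} = Δ(E')·(u³N)⁴` for
EVERY isogeny of odd degree (`Isogeny.exists_Δ_pow_degree_eq_mul_pow_four`, short model;
`…_four'`, any model, by the `u = 1` change to short form as in the Coates file). Valuations:
`deg φ · v_p(Δ_min(E)) ≡ v_p(Δ_min(E')) (mod 4)` for globally minimal `E, E'/ℚ`
(`Isogeny.padicValInt_minimalDiscriminantInt_modEq_four`), in particular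
`3·v_p(Δ_min(E)) ≡ v_p(Δ_min(E')) (mod 4)` for a `3`-isogeny
(`Isogeny.padicValInt_minimalDiscriminantInt_modEq_four_of_degree_eq_three`).

Cell context (nothing below is claimed to be proved here): route `TameQuarticManinParity`, LINE 20
(items F19 `TprimeRedNeronUnitForcesKodairaThree`, F19♭ `TprimeRedKodairaThreeForcesNeronUnit`):
for a tame-quartic curve at `3` (`ord_3 Δ_min ∈ {3, 9}`) and a `3`-isogenous globally minimal
`W₂`, `ord_3 Δ_min(W₂) ≡ 3·ord_3 Δ_min(W) (mod 4)`, so `ord_3 Δ_min(W₂) ≠ ord_3 Δ_min(W)`: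
there are NO "flat" `3`-edges on those rows — the clause of Gealy–Klagsbrun's Thm. 1 left open
by `IsogenyNeronScalingMinimalDiscriminantDirectionProofs` holds there for an algebraic reason.
BSD is not proved; no leaf, rung or crux is proved by this file.

## References
* [DokchitserDokchitser2015LocalInvariants] §2 Thm. 5 (arXiv p. 5), §3 Thm. 6 (p. 6), Table 1.
* [SilvermanAEC2009] Prop. III.4.12, Rem. III.4.13.2 (quotients by `Γ_K`-stable subgroups are
  defined over `K`), III.1 (changes of variables).
* [Velu1971] J. Vélu, C. R. Acad. Sci. Paris 273 (1971).
-/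

noncomputable section

open scoped Classical

open Finset

universe u

namespace WeierstrassCurve

namespace Isogeny

open geomPoints Affine Affine.Point Literature.NumberTheory.EllipticCurves

variable {K : Type u} [Field K] {W W' : WeierstrassCurve K}

/-! ### Galois invariance of `N = Π_{v ∈ ker φ ∖ O} 2y(v)` -/

/-- The kernel of a `K`-isogeny is `Γ_K`-stable (`φ(σP) = σφ(P) = σO = O`). Private copy (as in
the sibling files, to keep the import cone light). [folklore] -/
private theorem ker_smul_mem' (φ : Isogeny W W') (σ : Field.absoluteGaloisGroup K)
    (P : W.geomPoints) (hP : P ∈ φ.toAddMonoidHom.ker) : σ • P ∈ φ.toAddMonoidHom.ker := by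
  rw [AddMonoidHom.mem_ker, coe_toAddMonoidHom] at hP ⊢
  rw [φ.map_smul, hP, smul_zero]

/-- `y(R) = xy R 1`. Private plumbing. [folklore] -/
private theorem yOf_eq_xy (R : W.geomPoints) :
    yOf (R : (W⁄(AlgebraicClosure K)).toAffine.Point) = xy R 1 := by
  rcases R with _ | ⟨x, y, h⟩ <;> rfl

/-- `y(σ • R) = σ(y(R))`. Private plumbing. [folklore] -/
private theorem yOf_smul (σ : Field.absoluteGaloisGroup K) (R : W.geomPoints) :
    yOf ((σ • R : W.geomPoints) : (W⁄(AlgebraicClosure K)).toAffine.Point) =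
      galAut K σ (yOf (R : (W⁄(AlgebraicClosure K)).toAffine.Point)) := by
  rw [yOf_eq_xy, yOf_eq_xy, geomPoints.xy_smul]

/-- **`N = Π_{v ∈ ker φ ∖ O} 2y(v)` lies in `K`** (`K` perfect): the kernel of a `K`-isogeny is
`Γ_K`-stable and `y(σv) = σ(y(v))`, so every `σ ∈ Γ_K` permutes the factors and fixes `N`, and
`K̄^{Γ_K} = K` (Mathlib `InfiniteGalois.mem_range_algebraMap_iff_fixed`). Silverman, *AEC*,
Rem. III.4.13.2 (the quotient by a `Γ_K`-stable subgroup, and everything symmetric in it, is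
defined over `K`). [cite: SilvermanAEC2009, Rem. III.4.13.2] -/
theorem prod_two_mul_yOf_mem_range [PerfectField K] (φ : Isogeny W W')
    (hS : (φ.toAddMonoidHom.ker : Set W.geomPoints).Finite) :
    (∏ v ∈ hS.toFinset.erase (0 : W.geomPoints),
        (2 * yOf (v : (W⁄(AlgebraicClosure K)).toAffine.Point))) ∈
      Set.range (algebraMap K (AlgebraicClosure K)) := by
  haveI : IsGalois K (AlgebraicClosure K) := {}
  refine (InfiniteGalois.mem_range_algebraMap_iff_fixed _).mpr fun f => ?_
  set σ : Field.absoluteGaloisGroup K := f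
  rw [show (f : AlgebraicClosure K → AlgebraicClosure K) = galAut K σ from rfl, map_prod]
  -- membership in `ker φ ∖ O`
  have hmem : ∀ v : W.geomPoints, v ∈ hS.toFinset.erase (0 : W.geomPoints) ↔
      v ≠ 0 ∧ v ∈ φ.toAddMonoidHom.ker := by
    intro v
    rw [Finset.mem_erase, Set.Finite.mem_toFinset, SetLike.mem_coe]
  -- reindex the product along `v ↦ σ⁻¹ • v`
  symm
  refine Finset.prod_bij' (fun v _ => σ⁻¹ • v) (fun v _ => σ • v) ?_ ?_ ?_ ?_ ?_
  · intro v hv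
    obtain ⟨hv0, hvk⟩ := (hmem v).mp hv
    refine (hmem _).mpr ⟨fun h => hv0 ?_, ker_smul_mem' φ σ⁻¹ v hvk⟩
    have := congrArg (fun Q : W.geomPoints => σ • Q) h
    simpa using this
  · intro v hv
    obtain ⟨hv0, hvk⟩ := (hmem v).mp hv
    refine (hmem _).mpr ⟨fun h => hv0 ?_, ker_smul_mem' φ σ v hvk⟩
    have := congrArg (fun Q : W.geomPoints => σ⁻¹ • Q) h
    simpa using this
  · intro v _
    exact smul_inv_smul σ v
  · intro v _
    exact inv_smul_smul σ v
  · intro v _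
    rw [map_mul, map_ofNat, ← yOf_smul, smul_inv_smul]

/-! ### `Δ(E)^{deg φ} = Δ(E')·c⁴` for odd degree -/

/-- A kernel of odd order has no element of order `2`: if `-s = s` then `2s = 0`, so the order of
`s` divides `gcd(2, #ker φ) = 1`. [folklore] -/
private theorem eq_zero_of_neg_eq_of_odd (φ : Isogeny W W') (hodd : Odd φ.degree)
    (s : W.geomPoints) (hs : s ∈ φ.toAddMonoidHom.ker) (hneg : -s = s) : s = 0 := by
  haveI : Finite φ.toAddMonoidHom.ker := Nat.finite_of_card_ne_zero hodd.pos.ne'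
  have h2 : addOrderOf s ∣ 2 := by
    rw [addOrderOf_dvd_iff_nsmul_eq_zero, two_nsmul]
    nth_rw 1 [← hneg]
    exact neg_add_cancel s
  have hn : addOrderOf s ∣ φ.degree := by
    have h := addOrderOf_dvd_natCard (⟨s, hs⟩ : φ.toAddMonoidHom.ker)
    rwa [AddSubgroup.addOrderOf_mk] at h
  have hcop : Nat.Coprime 2 φ.degree := Nat.coprime_two_left.mpr hodd
  have h1 : addOrderOf s ∣ 1 := by
    rw [← hcop]
    exact Nat.dvd_gcd h2 hn
  exact AddMonoid.addOrderOf_eq_one_iff.mp (Nat.dvd_one.mp h1)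

/-- **Dokchitser–Dokchitser 2015, §2 Thm. 5, for the tree's isogenies and every ODD degree (short
model).** Let `K` be a number field, `E : y² = x³ + a₄x + a₆` and `φ : E → E'` a `K`-isogeny of
elliptic curves of odd degree. Then there is `c ∈ K` with `Δ(E)^{deg φ} = Δ(E')·c⁴` (explicitly
`c = u³·Π_{v ∈ ker φ ∖ O} 2y(v)`, `u` the scaling of `E/ker φ ≅ E'`). For `deg φ = 3` this is the
printed "`Δ³/Δ'` is a 4th power in `𝒦`" (proved there from the universal `3`-isogeny
`y² = x³ + a(x − b)²`; here from Vélu's quotient, its uniqueness, and Galois descent of `N`).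
[cite: DokchitserDokchitser2015LocalInvariants, §2 Thm. 5 (arXiv:1208.5519 p. 5: Δ³/Δ′ is a 4th power)] -/
theorem exists_Δ_pow_degree_eq_mul_pow_four [NumberField K] [W.IsShortNF] [W.IsElliptic]
    [W'.IsElliptic] (φ : Isogeny W W') (hodd : Odd φ.degree) :
    ∃ c : K, W.Δ ^ φ.degree = W'.Δ * c ^ 4 := by
  have hS : (φ.toAddMonoidHom.ker : Set W.geomPoints).Finite := φ.finite_ker
  have hodd' : ∀ s ∈ φ.toAddMonoidHom.ker, -s = s → s = 0 :=
    fun s hs hneg => eq_zero_of_neg_eq_of_odd φ hodd s hs hneg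
  obtain ⟨u, hu⟩ := φ.exists_unit_Δ_pow_card_ker_eq hS hodd'
  have hcard : hS.toFinset.card = φ.degree := by
    unfold Isogeny.degree
    rw [← SetLike.coe_sort_coe, Nat.card_coe_set_eq, Set.ncard_eq_toFinset_card _ hS]
  obtain ⟨g, hg⟩ := φ.prod_two_mul_yOf_mem_range hS
  -- read `hu` with the product indexed by `W.geomPoints` (definitionally the same finset)
  have hu' : algebraMap K (AlgebraicClosure K) W.Δ ^ hS.toFinset.card =
      algebraMap K (AlgebraicClosure K) ((u : K) ^ 12 * W'.Δ) *
        ∏ v ∈ hS.toFinset.erase (0 : W.geomPoints),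
          (2 * yOf (v : (W⁄(AlgebraicClosure K)).toAffine.Point)) ^ 4 := by
    convert hu using 4
    exact Finset.prod_bij' (fun v _ => v) (fun v _ => v)
      (fun v hv => (@Finset.mem_erase _ (_) _ _ _).mpr ((@Finset.mem_erase _ (_) _ _ _).mp hv))
      (fun v hv => (@Finset.mem_erase _ (_) _ _ _).mpr ((@Finset.mem_erase _ (_) _ _ _).mp hv))
      (fun _ _ => rfl) (fun _ _ => rfl) (fun _ _ => rfl)
  rw [Finset.prod_pow, ← hg] at hu'
  refine ⟨(u : K) ^ 3 * g, (algebraMap K (AlgebraicClosure K)).injective ?_⟩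
  rw [map_pow, ← hcard, hu']
  simp only [map_mul, map_pow]
  ring

/-- **The same for an arbitrary model of `E`** (the short-form hypothesis removed by the `u = 1`
change of variables `C = (1, −b₂/12, −a₁/2, a₁b₂/24 − a₃/2)` to short form, which preserves `Δ`,
transporting `φ` along `C • E ≅ E`; as in the sibling `exists_Δ_pow_eq_mul_pow_twelve'`): for a
`K`-isogeny `φ : E → E'` of elliptic curves over a number field of odd degree,
`Δ(E)^{deg φ} = Δ(E')·c⁴` for some `c ∈ K`.
[cite: DokchitserDokchitser2015LocalInvariants, §2 Thm. 5 (arXiv:1208.5519 p. 5)] -/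
theorem exists_Δ_pow_degree_eq_mul_pow_four' [NumberField K] [W.IsElliptic] [W'.IsElliptic]
    (φ : Isogeny W W') (hodd : Odd φ.degree) :
    ∃ c : K, W.Δ ^ φ.degree = W'.Δ * c ^ 4 := by
  haveI : Invertible (2 : K) := invertibleOfNonzero two_ne_zero
  haveI : Invertible (3 : K) := invertibleOfNonzero three_ne_zero
  set C : VariableChange K := ⟨1, -W.b₂ / 12, -W.a₁ / 2, W.a₁ * W.b₂ / 24 - W.a₃ / 2⟩ with hC
  obtain ⟨ha₁, ha₂, ha₃⟩ := shortChange_a₁_a₂_a₃ W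
  haveI : (C • W).IsShortNF := ⟨ha₁, ha₂, ha₃⟩
  have hΔ : (C • W).Δ = W.Δ := by rw [variableChange_Δ, hC]; simp
  -- transport the isogeny along `e : C • W ≅ W`; the kernel keeps its size
  obtain ⟨e, he⟩ := exists_bijective_of_smul W C
  have hdeg : (φ.comp e).degree = φ.degree := by
    unfold Isogeny.degree
    refine Nat.card_congr (Equiv.ofBijective
      (fun Q => ⟨e Q.1, by
        have hQ := Q.2
        rw [AddMonoidHom.mem_ker, coe_toAddMonoidHom, comp_apply] at hQ
        rwa [AddMonoidHom.mem_ker, coe_toAddMonoidHom]⟩) ⟨?_, ?_⟩)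
    · rintro ⟨Q₁, h₁⟩ ⟨Q₂, h₂⟩ h12
      have h := congrArg Subtype.val h12
      exact Subtype.ext (he.1 h)
    · rintro ⟨R, hR⟩
      obtain ⟨Q, hQ⟩ := he.2 R
      refine ⟨⟨Q, ?_⟩, Subtype.ext (by simpa using hQ)⟩
      rw [AddMonoidHom.mem_ker, coe_toAddMonoidHom, comp_apply, hQ]
      rwa [AddMonoidHom.mem_ker, coe_toAddMonoidHom] at hR
  obtain ⟨c, hc⟩ := (φ.comp e).exists_Δ_pow_degree_eq_mul_pow_four (by rwa [hdeg])
  exact ⟨c, by rw [← hΔ, ← hdeg]; exact hc⟩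

/-! ### Valuations: `deg φ · v_p(Δ_min(E)) ≡ v_p(Δ_min(E')) (mod 4)` -/

/-- **`deg φ · v_p(Δ_min(E)) ≡ v_p(Δ_min(E')) (mod 4)`** for globally minimal elliptic curves
`E, E'/ℚ` related by a `ℚ`-isogeny of odd degree, at every prime `p` (from
`Δ_min(E)^{deg φ} = Δ_min(E')·c⁴`, `c ∈ ℚˣ`). Dokchitser–Dokchitser 2015, Thm. 6
("`δ' ≡ pδ (mod 12)`", whose `mod 4` part is Thm. 5 at `p = 3`), here for every odd degree on the
tree's currency `padicValInt p W.minimalDiscriminantInt`.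
[cite: DokchitserDokchitser2015LocalInvariants, §3 Thm. 6 (δ′ ≡ pδ mod 12) with §2 Thm. 5 (arXiv:1208.5519 pp. 5–6)] -/
theorem padicValInt_minimalDiscriminantInt_modEq_four {W W' : WeierstrassCurve ℚ}
    [W.IsElliptic] [W'.IsElliptic] [W.IsGloballyMinimal] [W'.IsGloballyMinimal]
    (φ : Isogeny W W') (hodd : Odd φ.degree) (p : ℕ) [Fact p.Prime] :
    (φ.degree : ℤ) * padicValInt p W.minimalDiscriminantInt ≡
      padicValInt p W'.minimalDiscriminantInt [ZMOD 4] := by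
  obtain ⟨c, hc⟩ := φ.exists_Δ_pow_degree_eq_mul_pow_four' hodd
  have hΔ : W.Δ ≠ 0 := W.isUnit_Δ.ne_zero
  have hΔ' : W'.Δ ≠ 0 := W'.isUnit_Δ.ne_zero
  have hc0 : c ≠ 0 := by
    rintro rfl
    rw [zero_pow (by norm_num), mul_zero] at hc
    exact pow_ne_zero _ hΔ hc
  have hv := congrArg (padicValRat p) hc
  rw [padicValRat.pow, padicValRat.mul hΔ' (pow_ne_zero 4 hc0), padicValRat.pow] at hv
  rw [← padicValRat.of_int, ← padicValRat.of_int, W.cast_minimalDiscriminantInt,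
    W'.cast_minimalDiscriminantInt, Int.modEq_iff_dvd]
  exact ⟨-padicValRat p c, by push_cast at hv ⊢; linarith⟩

/-- **`3·v_p(Δ_min(E)) ≡ v_p(Δ_min(E')) (mod 4)` along a `3`-isogeny** of globally minimal
elliptic curves over `ℚ`, at every prime `p` — Dokchitser–Dokchitser 2015, §3 Thm. 6 at `p = 3`
("`δ' ≡ pδ (mod 12)`", the `mod 4` component; the `mod 3` component `δ' ≡ 0 ≡ 3δ` is specific to
the place `p = 3` of a tame curve and is NOT asserted here) from §2 Thm. 5 ("`Δ³/Δ'` is a 4th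
power"). At a place where `δ = ord_p Δ_min(E) ∈ {3, 9}` (Kodaira III / III*, e.g. the tame
quartic rows at `p = 3`): `δ' ≡ 3δ ≡ δ + 2δ ≢ δ (mod 4)`, so a `3`-isogeny never fixes `ord_p Δ_min`
there. [cite: DokchitserDokchitser2015LocalInvariants, §3 Thm. 6 with §2 Thm. 5 (arXiv:1208.5519 pp. 5–6) and Table 1 row "pot. supersingular tame: δ′ = 12 − δ" (p. 3)] -/
theorem padicValInt_minimalDiscriminantInt_modEq_four_of_degree_eq_three
    {W W' : WeierstrassCurve ℚ} [W.IsElliptic] [W'.IsElliptic] [W.IsGloballyMinimal]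
    [W'.IsGloballyMinimal] (φ : Isogeny W W') (h3 : φ.degree = 3) (p : ℕ) [Fact p.Prime] :
    3 * padicValInt p W.minimalDiscriminantInt ≡
      padicValInt p W'.minimalDiscriminantInt [ZMOD 4] := by
  have h := φ.padicValInt_minimalDiscriminantInt_modEq_four (by rw [h3]; decide) p
  rwa [h3, Nat.cast_ofNat] at h

/-- **No `3`-isogeny between globally minimal curves over `ℚ` preserves `ord_p Δ_min` at a place
where `ord_p Δ_min` is odd** (e.g. Kodaira III, III*: `δ ∈ {3, 9}`): `δ' ≡ 3δ (mod 4)` and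
`3δ ≢ δ (mod 4)` for odd `δ`. The algebraic substitute, on those rows, for clause (1) of
Gealy–Klagsbrun 2017 Thm. 1 (`v_min(E) ≠ v_min(E')` at a potentially supersingular prime).
[cite: DokchitserDokchitser2015LocalInvariants, §3 Thm. 6 with §2 Thm. 5 (arXiv:1208.5519 pp. 5–6)] -/
theorem padicValInt_minimalDiscriminantInt_ne_of_degree_eq_three_of_odd
    {W W' : WeierstrassCurve ℚ} [W.IsElliptic] [W'.IsElliptic] [W.IsGloballyMinimal]
    [W'.IsGloballyMinimal] (φ : Isogeny W W') (h3 : φ.degree = 3) (p : ℕ) [Fact p.Prime]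
    (hodd : Odd (padicValInt p W.minimalDiscriminantInt)) :
    padicValInt p W.minimalDiscriminantInt ≠ padicValInt p W'.minimalDiscriminantInt := by
  intro heq
  have h := φ.padicValInt_minimalDiscriminantInt_modEq_four_of_degree_eq_three h3 p
  rw [← heq, Int.modEq_iff_dvd] at h
  obtain ⟨k, hk⟩ := hodd
  obtain ⟨m, hm⟩ := h
  omega

end Isogeny

end WeierstrassCurve

end
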